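import Summits.QuantumFields.BalabanUV.Beta.EriceFlowEnclosurePolyLogLetters

/-!
# Beta / EriceFlowEnclosurePolyLogClosure — POLYLOGARITHMIC ASYMPTOTIC LETTERS, TRUNCATION ∕ SHIFT ∕ PEELING AND THE NONLINEAR
# CALCULUS (pure real analysis, SERVICE): truncation, division by y, peeling of the constant letter; products, powers, `log(1 + w)` and
# `(1 + w)⁻¹` of expansions `Σ_{k ≤ N} P_k(log y)∕y^k + O((1 + log y)^d∕y^{N+1})` with polynomial letters — the closure properties
# behind the induction step of P2 #36g `…InverseLawAllOrders.inverse_law_allOrders` (β-flow team,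
# prover 2 = lower ∕ positivity side, unit `b2b-balaban-beta-bflow-p2`, gen 21; module P2 #36g-B; companion P2 #36g-A `…PolyLogLetters`
# (the linear calculus, the shape «PL(N, f, P, A, d)» written out there and in every statement below))

HONEST FRAMING (page 1 of everything the β sub-cell writes): discharging `BetaPertH` makes Bałaban's UV stability UNCONDITIONAL — a
real constructive-QFT result; it is NOT the continuum limit and NOT the Clay problem.  HONEST DEPENDENCY (cell reorg 2026-08-19,
verbatim): «continuum YM on T⁴ ⇐ BetaPertH ∧ nine spine estimates (0/9 proved); BetaPertH ⇐ (D1) ∧ (D4) ∧ CAP+tail; G-an2-4 gates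
asym, D1 and NE2/3/4.»  THIS MODULE DISCHARGES NOTHING: [folklore] real analysis in abstract letters (the product by induction on the
order, peeling the constant letter — no Cauchy-product bookkeeping; the logarithmic and geometric series with Mathlib's
`Real.abs_log_sub_add_sum_range_le` and `mul_neg_geom_sum`); no Erice sentence is consumed; nothing of (1.22).

WHAT THIS FILE PROVES (0 sorry, 0 def, all [folklore]; letters EXISTENTIAL where new, the constant letter TRACKED): §0
`polyLog_truncate_succ` ∕ `polyLog_truncate` (dropping top letters into the error), `polyLog_shift` (division by y shifts the letters),
`polyLog_div_pow` (division by y^j, constant letter 0), `polyLog_peel` ((f − P₀(log y))·y carries the letters P_{k+1}); §1–§2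
**`polyLog_mul`** (PL(N, f, P) ∧ PL(N, g, Q) ⟹ PL(N, f·g, R) with R 0 = P 0·Q 0), `polyLog_pow` (f^j, constant letter (P 0)^j),
**`polyLog_log_one_add`** (PL(N, w, P) with P 0 = 0 and |w| ≤ 1∕2 eventually ⟹ PL(N, log(1 + w), R) with R 0 = 0),
**`polyLog_inv_one_add`** (same hypotheses ⟹ PL(N, (1 + w)⁻¹, R) with R 0 = 1).
NOT CLAIMED: explicit letters beyond the constant one; degree bookkeeping; anything about the β-flow.
-/

namespace Summit.QuantumFields.BalabanUV.Beta.EriceFlowEnclosurePolyLogClosure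

open Set Filter Topology
open Summit.QuantumFields.BalabanUV.Beta.EriceFlowEnclosurePolyLogLetters

noncomputable section

/-! ## §0 Truncation, shift, peeling (the rest of the linear calculus) -/

/-- **Truncation by one order**: the top letter falls into the error. [folklore] -/
theorem polyLog_truncate_succ {f : ℝ → ℝ} {N : ℕ} {P : ℕ → Polynomial ℝ} {A : ℝ} {d : ℕ}
    (hf : ∀ᶠ y : ℝ in atTop, |f y - ∑ k ∈ Finset.range (N + 1 + 1), (P k).eval (Real.log y) / y ^ k|
      ≤ A * (1 + Real.log y) ^ d / y ^ (N + 1 + 1)) :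
    ∃ A' : ℝ, ∃ d' : ℕ, ∀ᶠ y : ℝ in atTop,
      |f y - ∑ k ∈ Finset.range (N + 1), (P k).eval (Real.log y) / y ^ k| ≤ A' * (1 + Real.log y) ^ d' / y ^ (N + 1) := by
  obtain ⟨c, hc, h⟩ := eval_abs_le (P (N + 1))
  refine ⟨|A| + c, max d (P (N + 1)).natDegree, ?_⟩
  filter_upwards [hf, eventually_ge_atTop (1 : ℝ)] with y hy hy1
  have hy0 : 0 < y := by linarith
  have hL : 0 ≤ Real.log y := Real.log_nonneg hy1
  have h1L : 1 ≤ 1 + Real.log y := by linarith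
  have hyp : 0 < y ^ (N + 1) := pow_pos hy0 _
  set W : ℝ := (1 + Real.log y) ^ max d (P (N + 1)).natDegree / y ^ (N + 1) with hW
  have e1 : ∑ k ∈ Finset.range (N + 1 + 1), (P k).eval (Real.log y) / y ^ k
      = ∑ k ∈ Finset.range (N + 1), (P k).eval (Real.log y) / y ^ k + (P (N + 1)).eval (Real.log y) / y ^ (N + 1) :=
    Finset.sum_range_succ _ _
  have h1 : A * (1 + Real.log y) ^ d / y ^ (N + 1 + 1) ≤ |A| * W := by
    rw [hW, ← mul_div_assoc]
    have hyN : y ^ (N + 1) ≤ y ^ (N + 1 + 1) := pow_le_pow_right₀ hy1 (by omega)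
    calc A * (1 + Real.log y) ^ d / y ^ (N + 1 + 1) ≤ |A| * (1 + Real.log y) ^ max d (P (N + 1)).natDegree / y ^ (N + 1 + 1) :=
          div_le_div_of_nonneg_right (mul_le_mul (le_abs_self A) (pow_le_pow_right₀ h1L (le_max_left _ _))
            (by positivity) (abs_nonneg A)) (by positivity)
      _ ≤ |A| * (1 + Real.log y) ^ max d (P (N + 1)).natDegree / y ^ (N + 1) :=
          div_le_div_of_nonneg_left (by positivity) hyp hyN
  have h2 : |(P (N + 1)).eval (Real.log y) / y ^ (N + 1)| ≤ c * W := by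
    rw [hW, ← mul_div_assoc, abs_div, abs_of_pos hyp]
    exact div_le_div_of_nonneg_right ((h _ hL).trans
      (mul_le_mul_of_nonneg_left (pow_le_pow_right₀ h1L (le_max_right _ _)) hc)) hyp.le
  calc |f y - ∑ k ∈ Finset.range (N + 1), (P k).eval (Real.log y) / y ^ k|
      = |(f y - ∑ k ∈ Finset.range (N + 1 + 1), (P k).eval (Real.log y) / y ^ k)
          + (P (N + 1)).eval (Real.log y) / y ^ (N + 1)| := by rw [e1]; congr 1; ring
    _ ≤ |f y - ∑ k ∈ Finset.range (N + 1 + 1), (P k).eval (Real.log y) / y ^ k|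
          + |(P (N + 1)).eval (Real.log y) / y ^ (N + 1)| := abs_add_le _ _
    _ ≤ |A| * W + c * W := add_le_add (hy.trans h1) h2
    _ = (|A| + c) * (1 + Real.log y) ^ max d (P (N + 1)).natDegree / y ^ (N + 1) := by rw [hW]; ring

/-- **Truncation**: PL at order `N + j` gives PL at order `N` (same letters below). [folklore] -/
theorem polyLog_truncate {f : ℝ → ℝ} {N : ℕ} {P : ℕ → Polynomial ℝ} :
    ∀ (j : ℕ) {A : ℝ} {d : ℕ},
      (∀ᶠ y : ℝ in atTop, |f y - ∑ k ∈ Finset.range (N + j + 1), (P k).eval (Real.log y) / y ^ k|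
        ≤ A * (1 + Real.log y) ^ d / y ^ (N + j + 1)) →
      ∃ A' : ℝ, ∃ d' : ℕ, ∀ᶠ y : ℝ in atTop,
        |f y - ∑ k ∈ Finset.range (N + 1), (P k).eval (Real.log y) / y ^ k| ≤ A' * (1 + Real.log y) ^ d' / y ^ (N + 1) := by
  intro j
  induction j with
  | zero => intro A d h; exact ⟨A, d, by simpa using h⟩
  | succ j ih =>
    intro A d h
    have h' : ∀ᶠ y : ℝ in atTop, |f y - ∑ k ∈ Finset.range (N + j + 1 + 1), (P k).eval (Real.log y) / y ^ k|
        ≤ A * (1 + Real.log y) ^ d / y ^ (N + j + 1 + 1) := by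
      have e : N + (j + 1) + 1 = N + j + 1 + 1 := by ring
      rw [e] at h
      exact h
    obtain ⟨A', d', h''⟩ := polyLog_truncate_succ h'
    exact ih h''

/-- **Shift**: dividing by `y` shifts the letters up by one (`P↑ 0 = 0`, `P↑ (k+1) = P k`), same constant and exponent. [folklore] -/
theorem polyLog_shift {f : ℝ → ℝ} {N : ℕ} {P : ℕ → Polynomial ℝ} {A : ℝ} {d : ℕ}
    (hf : ∀ᶠ y : ℝ in atTop, |f y - ∑ k ∈ Finset.range (N + 1), (P k).eval (Real.log y) / y ^ k|
      ≤ A * (1 + Real.log y) ^ d / y ^ (N + 1)) :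
    ∀ᶠ y : ℝ in atTop,
      |f y / y - ∑ k ∈ Finset.range (N + 1 + 1),
          ((fun k : ℕ => if k = 0 then (0 : Polynomial ℝ) else P (k - 1)) k).eval (Real.log y) / y ^ k|
        ≤ A * (1 + Real.log y) ^ d / y ^ (N + 1 + 1) := by
  filter_upwards [hf, eventually_gt_atTop (0 : ℝ)] with y hy hy0
  have e1 : ∑ k ∈ Finset.range (N + 1 + 1),
      ((fun k : ℕ => if k = 0 then (0 : Polynomial ℝ) else P (k - 1)) k).eval (Real.log y) / y ^ k
      = (∑ k ∈ Finset.range (N + 1), (P k).eval (Real.log y) / y ^ k) / y := by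
    rw [Finset.sum_range_succ', Finset.sum_div]
    simp only [Nat.succ_ne_zero, if_false, Nat.add_sub_cancel, if_true, Polynomial.eval_zero, zero_div, add_zero]
    refine Finset.sum_congr rfl fun k _ => ?_
    rw [pow_succ, div_div]
  rw [e1, ← sub_div, abs_div, abs_of_pos hy0, pow_succ (y) (N + 1), ← div_div]
  exact div_le_div_of_nonneg_right hy hy0.le

/-- **Division by y^j**: PL at the same order, with SOME letters whose constant letter vanishes for `j ≥ 1`. [folklore] -/
theorem polyLog_div_pow {f : ℝ → ℝ} {N : ℕ} {P : ℕ → Polynomial ℝ} {A : ℝ} {d : ℕ}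
    (hf : ∀ᶠ y : ℝ in atTop, |f y - ∑ k ∈ Finset.range (N + 1), (P k).eval (Real.log y) / y ^ k|
      ≤ A * (1 + Real.log y) ^ d / y ^ (N + 1)) :
    ∀ j : ℕ, ∃ (P' : ℕ → Polynomial ℝ) (A' : ℝ) (d' : ℕ), (0 < j → P' 0 = 0) ∧ ∀ᶠ y : ℝ in atTop,
      |f y / y ^ j - ∑ k ∈ Finset.range (N + 1), (P' k).eval (Real.log y) / y ^ k| ≤ A' * (1 + Real.log y) ^ d' / y ^ (N + 1) := by
  intro j
  induction j with
  | zero =>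
    refine ⟨P, A, d, fun h => absurd h (lt_irrefl 0), ?_⟩
    filter_upwards [hf] with y hy
    simpa only [pow_zero, div_one] using hy
  | succ j ih =>
    obtain ⟨P', A', d', -, h⟩ := ih
    have h1 := polyLog_shift h
    obtain ⟨A'', d'', h2⟩ := polyLog_truncate_succ h1
    refine ⟨fun k : ℕ => if k = 0 then (0 : Polynomial ℝ) else P' (k - 1), A'', d'', fun _ => by simp, ?_⟩
    filter_upwards [h2] with y hy
    have e : f y / y ^ (j + 1) = f y / y ^ j / y := by rw [pow_succ, div_div]
    rw [e]
    exact hy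

/-- **Peeling the constant letter**: `(f − P₀(log y))·y` carries the letters `P_{k+1}` at one order less, same constant and exponent.
[folklore] -/
theorem polyLog_peel {f : ℝ → ℝ} {N : ℕ} {P : ℕ → Polynomial ℝ} {A : ℝ} {d : ℕ}
    (hf : ∀ᶠ y : ℝ in atTop, |f y - ∑ k ∈ Finset.range (N + 1 + 1), (P k).eval (Real.log y) / y ^ k|
      ≤ A * (1 + Real.log y) ^ d / y ^ (N + 1 + 1)) :
    ∀ᶠ y : ℝ in atTop,
      |(f y - (P 0).eval (Real.log y)) * y - ∑ k ∈ Finset.range (N + 1), ((fun k => P (k + 1)) k).eval (Real.log y) / y ^ k|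
        ≤ A * (1 + Real.log y) ^ d / y ^ (N + 1) := by
  filter_upwards [hf, eventually_gt_atTop (0 : ℝ)] with y hy hy0
  have e1 : ∑ k ∈ Finset.range (N + 1 + 1), (P k).eval (Real.log y) / y ^ k
      = (P 0).eval (Real.log y) + (∑ k ∈ Finset.range (N + 1), (P (k + 1)).eval (Real.log y) / y ^ k) / y := by
    rw [Finset.sum_range_succ', Finset.sum_div, add_comm]
    simp only [pow_zero, div_one]
    congr 1
    refine Finset.sum_congr rfl fun k _ => ?_
    rw [pow_succ, div_div]
  have e2 : (f y - (P 0).eval (Real.log y)) * y - ∑ k ∈ Finset.range (N + 1), ((fun k => P (k + 1)) k).eval (Real.log y) / y ^ k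
      = (f y - ∑ k ∈ Finset.range (N + 1 + 1), (P k).eval (Real.log y) / y ^ k) * y := by
    rw [e1]
    field_simp
    ring
  rw [e2, abs_mul, abs_of_pos hy0]
  calc |f y - ∑ k ∈ Finset.range (N + 1 + 1), (P k).eval (Real.log y) / y ^ k| * y
      ≤ A * (1 + Real.log y) ^ d / y ^ (N + 1 + 1) * y := mul_le_mul_of_nonneg_right hy hy0.le
    _ = A * (1 + Real.log y) ^ d / y ^ (N + 1) := by
        rw [pow_succ (y) (N + 1)]
        field_simp

/-! ## §1 Products and powers -/

/-- **Product**: by induction on the order, peeling the constant letters: `f = P₀(L) + f₁∕y`, `g = Q₀(L) + g₁∕y`,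
`f·g = P₀Q₀ + (P₀·g₁ + Q₀·f₁)∕y + f₁g₁∕y²`. The constant letter of the product is `P 0 · Q 0`. [folklore] -/
theorem polyLog_mul : ∀ (N : ℕ) {f g : ℝ → ℝ} {P Q : ℕ → Polynomial ℝ} {A B : ℝ} {d e : ℕ},
    (∀ᶠ y : ℝ in atTop, |f y - ∑ k ∈ Finset.range (N + 1), (P k).eval (Real.log y) / y ^ k|
      ≤ A * (1 + Real.log y) ^ d / y ^ (N + 1)) →
    (∀ᶠ y : ℝ in atTop, |g y - ∑ k ∈ Finset.range (N + 1), (Q k).eval (Real.log y) / y ^ k|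
      ≤ B * (1 + Real.log y) ^ e / y ^ (N + 1)) →
    ∃ (R : ℕ → Polynomial ℝ) (A' : ℝ) (d' : ℕ), R 0 = P 0 * Q 0 ∧ ∀ᶠ y : ℝ in atTop,
      |f y * g y - ∑ k ∈ Finset.range (N + 1), (R k).eval (Real.log y) / y ^ k| ≤ A' * (1 + Real.log y) ^ d' / y ^ (N + 1) := by
  intro N
  induction N with
  | zero =>
    intro f g P Q A B d e hf hg
    obtain ⟨cg, Dg, hcg, hgb⟩ := abs_le_of_polyLog hg
    obtain ⟨cP, hcP, hPb⟩ := eval_abs_le (P 0)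
    refine ⟨fun _ => P 0 * Q 0, |A| * cg + cP * |B|, d + Dg + ((P 0).natDegree + e), rfl, ?_⟩
    filter_upwards [hf, hg, hgb, eventually_ge_atTop (1 : ℝ)] with y hy hy' hyg hy1
    have hy0 : 0 < y := by linarith
    have hL : 0 ≤ Real.log y := Real.log_nonneg hy1
    have h1L : 1 ≤ 1 + Real.log y := by linarith
    simp only [zero_add, Finset.sum_range_one, pow_zero, div_one, pow_one] at hy hy' ⊢
    rw [Polynomial.eval_mul]
    have e1 : f y * g y - (P 0).eval (Real.log y) * (Q 0).eval (Real.log y)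
        = (f y - (P 0).eval (Real.log y)) * g y + (P 0).eval (Real.log y) * (g y - (Q 0).eval (Real.log y)) := by ring
    rw [e1]
    set M : ℕ := d + Dg + ((P 0).natDegree + e) with hM
    have hA' : |f y - (P 0).eval (Real.log y)| ≤ |A| * (1 + Real.log y) ^ d / y :=
      hy.trans (div_le_div_of_nonneg_right (mul_le_mul_of_nonneg_right (le_abs_self A) (by positivity)) hy0.le)
    have hB' : |g y - (Q 0).eval (Real.log y)| ≤ |B| * (1 + Real.log y) ^ e / y :=
      hy'.trans (div_le_div_of_nonneg_right (mul_le_mul_of_nonneg_right (le_abs_self B) (by positivity)) hy0.le)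
    have t1 : |(f y - (P 0).eval (Real.log y)) * g y| ≤ |A| * cg * (1 + Real.log y) ^ M / y := by
      rw [abs_mul]
      calc |f y - (P 0).eval (Real.log y)| * |g y| ≤ (|A| * (1 + Real.log y) ^ d / y) * (cg * (1 + Real.log y) ^ Dg) :=
            mul_le_mul hA' hyg (abs_nonneg _) (by positivity)
        _ = |A| * cg * (1 + Real.log y) ^ (d + Dg) / y := by rw [pow_add]; ring
        _ ≤ |A| * cg * (1 + Real.log y) ^ M / y :=
            div_le_div_of_nonneg_right (mul_le_mul_of_nonneg_left (pow_le_pow_right₀ h1L (by omega)) (by positivity)) hy0.le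
    have t2 : |(P 0).eval (Real.log y) * (g y - (Q 0).eval (Real.log y))| ≤ cP * |B| * (1 + Real.log y) ^ M / y := by
      rw [abs_mul]
      calc |(P 0).eval (Real.log y)| * |g y - (Q 0).eval (Real.log y)|
          ≤ (cP * (1 + Real.log y) ^ (P 0).natDegree) * (|B| * (1 + Real.log y) ^ e / y) :=
            mul_le_mul (hPb _ hL) hB' (abs_nonneg _) (by positivity)
        _ = cP * |B| * (1 + Real.log y) ^ ((P 0).natDegree + e) / y := by rw [pow_add]; ring
        _ ≤ cP * |B| * (1 + Real.log y) ^ M / y :=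
            div_le_div_of_nonneg_right (mul_le_mul_of_nonneg_left (pow_le_pow_right₀ h1L (by omega)) (by positivity)) hy0.le
    calc _ ≤ |(f y - (P 0).eval (Real.log y)) * g y| + |(P 0).eval (Real.log y) * (g y - (Q 0).eval (Real.log y))| :=
          abs_add_le _ _
      _ ≤ |A| * cg * (1 + Real.log y) ^ M / y + cP * |B| * (1 + Real.log y) ^ M / y := add_le_add t1 t2
      _ = (|A| * cg + cP * |B|) * (1 + Real.log y) ^ M / y := by ring
  | succ N ih =>
    intro f g P Q A B d e hf hg
    -- peel the constant letters
    have hf₁ := polyLog_peel hf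
    have hg₁ := polyLog_peel hg
    -- f₁ g₁ ∈ PL(N), then ∕y² and truncate back to order N + 1
    obtain ⟨R₁, A₁, d₁, -, h₁⟩ := ih hf₁ hg₁
    obtain ⟨A₂, d₂, h₂⟩ := polyLog_truncate_succ (polyLog_shift (polyLog_shift h₁))
    -- the cross terms
    obtain ⟨A₃, d₃, h₃⟩ := polyLog_smul_poly (P 0) (polyLog_shift hg₁)
    obtain ⟨A₄, d₄, h₄⟩ := polyLog_smul_poly (Q 0) (polyLog_shift hf₁)
    -- the constant term
    have h₅ := polyLog_of_poly (P 0 * Q 0) (N + 1)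
    obtain ⟨A₆, d₆, h₆⟩ := polyLog_add h₅ h₃
    obtain ⟨A₇, d₇, h₇⟩ := polyLog_add h₆ h₄
    obtain ⟨A₈, d₈, h₈⟩ := polyLog_add h₇ h₂
    refine ⟨_, A₈, d₈, ?_, polyLog_congr h₈ ?_⟩
    · simp
    · filter_upwards [eventually_gt_atTop (0 : ℝ)] with y hy
      have hy' : y ≠ 0 := hy.ne'
      rw [Polynomial.eval_mul]
      field_simp
      ring

/-- **Powers**: `f^j` is PL with constant letter `(P 0)^j`. [folklore] -/
theorem polyLog_pow {N : ℕ} {f : ℝ → ℝ} {P : ℕ → Polynomial ℝ} {A : ℝ} {d : ℕ}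
    (hf : ∀ᶠ y : ℝ in atTop, |f y - ∑ k ∈ Finset.range (N + 1), (P k).eval (Real.log y) / y ^ k|
      ≤ A * (1 + Real.log y) ^ d / y ^ (N + 1)) :
    ∀ j : ℕ, ∃ (R : ℕ → Polynomial ℝ) (A' : ℝ) (d' : ℕ), R 0 = (P 0) ^ j ∧ ∀ᶠ y : ℝ in atTop,
      |f y ^ j - ∑ k ∈ Finset.range (N + 1), (R k).eval (Real.log y) / y ^ k| ≤ A' * (1 + Real.log y) ^ d' / y ^ (N + 1) := by
  intro j
  induction j with
  | zero =>
    refine ⟨fun k => if k = 0 then (1 : Polynomial ℝ) else 0, 0, 0, by simp, ?_⟩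
    refine polyLog_congr (polyLog_of_poly (1 : Polynomial ℝ) N) (Eventually.of_forall fun y => ?_)
    simp
  | succ j ih =>
    obtain ⟨R, A', d', hR0, h⟩ := ih
    obtain ⟨R', A'', d'', hR'0, h'⟩ := polyLog_mul N h hf
    refine ⟨R', A'', d'', by rw [hR'0, hR0, pow_succ], polyLog_congr h' (Eventually.of_forall fun y => ?_)⟩
    rw [pow_succ]

/-! ## §2 The logarithm and the inverse of `1 + w`, `w` small without constant letter -/

/-- **`log(1 + w)`**: if `w` is PL at order N with vanishing constant letter and `|w| ≤ 1∕2` eventually, then `log(1 + w)` is PL at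
order N with vanishing constant letter — the logarithmic series to order N + 1 (`|log(1 + w) − Σ_{i ≤ N} (−1)^i w^{i+1}∕(i+1)| ≤ 2|w|^{N+2}`,
Mathlib) and `|w| = O((1 + log y)^D∕y)`. [folklore] -/
theorem polyLog_log_one_add {N : ℕ} {w : ℝ → ℝ} {P : ℕ → Polynomial ℝ} {A : ℝ} {d : ℕ}
    (hw : ∀ᶠ y : ℝ in atTop, |w y - ∑ k ∈ Finset.range (N + 1), (P k).eval (Real.log y) / y ^ k|
      ≤ A * (1 + Real.log y) ^ d / y ^ (N + 1)) (hP0 : P 0 = 0)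
    (hsmall : ∀ᶠ y : ℝ in atTop, |w y| ≤ 1 / 2) :
    ∃ (R : ℕ → Polynomial ℝ) (A' : ℝ) (d' : ℕ), R 0 = 0 ∧ ∀ᶠ y : ℝ in atTop,
      |Real.log (1 + w y) - ∑ k ∈ Finset.range (N + 1), (R k).eval (Real.log y) / y ^ k|
        ≤ A' * (1 + Real.log y) ^ d' / y ^ (N + 1) := by
  obtain ⟨c, D, hc, hcrude⟩ := abs_le_div_of_polyLog hw hP0
  choose R A' d' hR0 hR using polyLog_pow hw
  -- the truncated logarithmic series T y := Σ_{i<N+1} ((−1)^i∕(i+1))·w y^(i+1)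
  obtain ⟨AT, dT, hT⟩ := polyLog_sum (N := N) (fun i y => ((-1 : ℝ) ^ i / (i + 1)) * w y ^ (i + 1))
    (fun i k => Polynomial.C ((-1 : ℝ) ^ i / (i + 1)) * R (i + 1) k) (N + 1)
    (fun i _ => ⟨_, _, polyLog_const_mul ((-1 : ℝ) ^ i / (i + 1)) (hR (i + 1))⟩)
  -- the remainder is a pure error term
  have hρ : ∀ᶠ y : ℝ in atTop, |Real.log (1 + w y) - ∑ i ∈ Finset.range (N + 1), ((-1 : ℝ) ^ i / (i + 1)) * w y ^ (i + 1)|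
      ≤ 2 * c ^ (N + 1 + 1) * (1 + Real.log y) ^ (D * (N + 1 + 1)) / y ^ (N + 1) := by
    filter_upwards [hsmall, hcrude, eventually_ge_atTop (1 : ℝ)] with y hws hwc hy1
    have hy0 : 0 < y := by linarith
    have hL : 0 ≤ Real.log y := Real.log_nonneg hy1
    have habs : |(-w y)| < 1 := by rw [abs_neg]; linarith
    have hser := Real.abs_log_sub_add_sum_range_le habs (N + 1)
    have e1 : ∑ i ∈ Finset.range (N + 1), (-w y) ^ (i + 1) / ((i : ℝ) + 1)
        = -∑ i ∈ Finset.range (N + 1), ((-1 : ℝ) ^ i / (i + 1)) * w y ^ (i + 1) := by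
      rw [← Finset.sum_neg_distrib]
      refine Finset.sum_congr rfl fun i _ => ?_
      rw [neg_pow, pow_succ]
      ring
    rw [e1, sub_neg_eq_add, abs_neg, ← sub_eq_neg_add] at hser
    have h2 : |w y| ^ (N + 1 + 1) / (1 - |w y|) ≤ 2 * |w y| ^ (N + 1 + 1) := by
      rw [div_le_iff₀ (by linarith)]
      nlinarith [pow_nonneg (abs_nonneg (w y)) (N + 1 + 1)]
    have h3 : |w y| ^ (N + 1 + 1) ≤ c ^ (N + 1 + 1) * (1 + Real.log y) ^ (D * (N + 1 + 1)) / y ^ (N + 1 + 1) := by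
      calc |w y| ^ (N + 1 + 1) ≤ (c * (1 + Real.log y) ^ D / y) ^ (N + 1 + 1) := pow_le_pow_left₀ (abs_nonneg _) hwc _
        _ = c ^ (N + 1 + 1) * (1 + Real.log y) ^ (D * (N + 1 + 1)) / y ^ (N + 1 + 1) := by
            rw [div_pow, mul_pow, ← pow_mul]
    have h4 : c ^ (N + 1 + 1) * (1 + Real.log y) ^ (D * (N + 1 + 1)) / y ^ (N + 1 + 1)
        ≤ c ^ (N + 1 + 1) * (1 + Real.log y) ^ (D * (N + 1 + 1)) / y ^ (N + 1) :=
      div_le_div_of_nonneg_left (by positivity) (pow_pos hy0 _) (pow_le_pow_right₀ hy1 (by omega))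
    calc _ ≤ |w y| ^ (N + 1 + 1) / (1 - |w y|) := hser
      _ ≤ 2 * |w y| ^ (N + 1 + 1) := h2
      _ ≤ 2 * (c ^ (N + 1 + 1) * (1 + Real.log y) ^ (D * (N + 1 + 1)) / y ^ (N + 1)) := by linarith [h3.trans h4]
      _ = _ := by ring
  obtain ⟨A'', d'', h⟩ := polyLog_add hT (polyLog_of_error hρ)
  refine ⟨_, A'', d'', ?_, polyLog_congr h (Eventually.of_forall fun y => by ring)⟩
  simp only [add_zero]
  refine Finset.sum_eq_zero fun i _ => ?_
  rw [hR0, hP0, zero_pow (Nat.succ_ne_zero i), mul_zero]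

/-- **`(1 + w)⁻¹`**: if `w` is PL at order N with vanishing constant letter and `|w| ≤ 1∕2` eventually, then `(1 + w)⁻¹` is PL at
order N with constant letter 1 — the geometric series to order N + 1 (`(1 + w)·Σ_{i ≤ N+1} (−w)^i = 1 − (−w)^{N+2}`, Mathlib
`mul_neg_geom_sum`) and `|w| = O((1 + log y)^D∕y)`. [folklore] -/
theorem polyLog_inv_one_add {N : ℕ} {w : ℝ → ℝ} {P : ℕ → Polynomial ℝ} {A : ℝ} {d : ℕ}
    (hw : ∀ᶠ y : ℝ in atTop, |w y - ∑ k ∈ Finset.range (N + 1), (P k).eval (Real.log y) / y ^ k|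
      ≤ A * (1 + Real.log y) ^ d / y ^ (N + 1)) (hP0 : P 0 = 0)
    (hsmall : ∀ᶠ y : ℝ in atTop, |w y| ≤ 1 / 2) :
    ∃ (R : ℕ → Polynomial ℝ) (A' : ℝ) (d' : ℕ), R 0 = 1 ∧ ∀ᶠ y : ℝ in atTop,
      |(1 + w y)⁻¹ - ∑ k ∈ Finset.range (N + 1), (R k).eval (Real.log y) / y ^ k|
        ≤ A' * (1 + Real.log y) ^ d' / y ^ (N + 1) := by
  obtain ⟨c, D, hc, hcrude⟩ := abs_le_div_of_polyLog hw hP0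
  choose R A' d' hR0 hR using polyLog_pow hw
  -- the truncated geometric series T y := Σ_{i<N+2} (−1)^i·w y^i
  obtain ⟨AT, dT, hT⟩ := polyLog_sum (N := N) (fun i y => (-1 : ℝ) ^ i * w y ^ i)
    (fun i k => Polynomial.C ((-1 : ℝ) ^ i) * R i k) (N + 1 + 1)
    (fun i _ => ⟨_, _, polyLog_const_mul ((-1 : ℝ) ^ i) (hR i)⟩)
  have hρ : ∀ᶠ y : ℝ in atTop, |(1 + w y)⁻¹ - ∑ i ∈ Finset.range (N + 1 + 1), (-1 : ℝ) ^ i * w y ^ i|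
      ≤ 2 * c ^ (N + 1 + 1) * (1 + Real.log y) ^ (D * (N + 1 + 1)) / y ^ (N + 1) := by
    filter_upwards [hsmall, hcrude, eventually_ge_atTop (1 : ℝ)] with y hws hwc hy1
    have hy0 : 0 < y := by linarith
    have hL : 0 ≤ Real.log y := Real.log_nonneg hy1
    have hwlo : -(1 / 2) ≤ w y := by linarith [neg_abs_le (w y)]
    have hpos : 0 < 1 + w y := by linarith
    have hgeom := mul_neg_geom_sum (-w y) (N + 1 + 1)
    rw [sub_neg_eq_add] at hgeom
    have e1 : ∑ i ∈ Finset.range (N + 1 + 1), (-1 : ℝ) ^ i * w y ^ i = ∑ i ∈ Finset.range (N + 1 + 1), (-w y) ^ i := by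
      refine Finset.sum_congr rfl fun i _ => ?_
      exact (neg_pow (w y) i).symm
    have e2 : (1 + w y)⁻¹ - ∑ i ∈ Finset.range (N + 1 + 1), (-1 : ℝ) ^ i * w y ^ i = (1 + w y)⁻¹ * (-w y) ^ (N + 1 + 1) := by
      rw [e1]
      have : ∑ i ∈ Finset.range (N + 1 + 1), (-w y) ^ i = (1 + w y)⁻¹ * (1 - (-w y) ^ (N + 1 + 1)) := by
        rw [← hgeom, ← mul_assoc, inv_mul_cancel₀ hpos.ne', one_mul]
      rw [this]
      ring
    rw [e2, abs_mul, abs_inv, abs_of_pos hpos, abs_pow, abs_neg]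
    have hinv : (1 + w y)⁻¹ ≤ 2 := by
      rw [inv_le_comm₀ hpos (by norm_num)]
      linarith
    have h3 : |w y| ^ (N + 1 + 1) ≤ c ^ (N + 1 + 1) * (1 + Real.log y) ^ (D * (N + 1 + 1)) / y ^ (N + 1 + 1) := by
      calc |w y| ^ (N + 1 + 1) ≤ (c * (1 + Real.log y) ^ D / y) ^ (N + 1 + 1) := pow_le_pow_left₀ (abs_nonneg _) hwc _
        _ = c ^ (N + 1 + 1) * (1 + Real.log y) ^ (D * (N + 1 + 1)) / y ^ (N + 1 + 1) := by
            rw [div_pow, mul_pow, ← pow_mul]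
    have h4 : c ^ (N + 1 + 1) * (1 + Real.log y) ^ (D * (N + 1 + 1)) / y ^ (N + 1 + 1)
        ≤ c ^ (N + 1 + 1) * (1 + Real.log y) ^ (D * (N + 1 + 1)) / y ^ (N + 1) :=
      div_le_div_of_nonneg_left (by positivity) (pow_pos hy0 _) (pow_le_pow_right₀ hy1 (by omega))
    calc (1 + w y)⁻¹ * |w y| ^ (N + 1 + 1) ≤ 2 * |w y| ^ (N + 1 + 1) :=
          mul_le_mul_of_nonneg_right hinv (pow_nonneg (abs_nonneg _) _)
      _ ≤ 2 * (c ^ (N + 1 + 1) * (1 + Real.log y) ^ (D * (N + 1 + 1)) / y ^ (N + 1)) := by linarith [h3.trans h4]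
      _ = _ := by ring
  obtain ⟨A'', d'', h⟩ := polyLog_add hT (polyLog_of_error hρ)
  refine ⟨_, A'', d'', ?_, polyLog_congr h (Eventually.of_forall fun y => by ring)⟩
  simp only [add_zero]
  rw [Finset.sum_range_succ']
  have hz : ∑ i ∈ Finset.range (N + 1), Polynomial.C ((-1 : ℝ) ^ (i + 1)) * R (i + 1) 0 = 0 := by
    refine Finset.sum_eq_zero fun i _ => ?_
    rw [hR0, hP0, zero_pow (Nat.succ_ne_zero i), mul_zero]
  rw [hz, hR0, pow_zero, pow_zero, mul_one, zero_add, Polynomial.C_1]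

end

end Summit.QuantumFields.BalabanUV.Beta.EriceFlowEnclosurePolyLogClosure
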